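import Summits.BirchSwinnertonDyer.BirchSwinnertonDyer.Theorems.BiquadraticEisensteinDescentManinDatumSupercuspidalCMInertResolventLabelsJZero
import HarnessLib

set_option linter.dupNamespace false -- `Summit.BirchSwinnertonDyer.BirchSwinnertonDyer.Theorems.…` (summit = sub, D-0017)
set_option autoImplicit false

/-!
# Crux `ManinDatumSupercuspidalCMInert` (stmt-BirchSwinnertonDyer-20111, BED r605), stub `stub_S5` (`j = 0` at `p = 5`) — the ORBIT FORM of the
# resolvents: for a weight `Φ` on `(ℤ/5)²` with the axioms of `(·/5)₆^k`, `Σ_d Φ(d)·π_dⁿ = 6·Σ_{a<4} (−ρ²)^{ak}·π_{e_a}ⁿ` whenever `3 ∣ k + 2n`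

Route `BiquadraticEisensteinDescent` (cell `pub/bsd-wall`, width seat `bsd-wall-cm-bed-w1` g8; `--supports` stmt-BirchSwinnertonDyer-20111,
helper). THEOREMS ONLY (no definition, no named fact, no `sorry`); nothing is closed by this file and BSD is not proved by any of it.

The weight is ABSTRACT but pinned by the axioms of `χ^k`, `χ = (·/5)₆`, in the coordinates `d ↔ d₁ρ + d₂` of `ℤ[ρ]/5`: `Φ 0 = 0`, `Φ(0,1) = 1`,
`Φ(−d) = Φ(d)`, `Φ(ρ·d) = ρ^kΦ(d)` (`ρ·d = (d₂ − d₁, −d₁)`; `χ(ρ) = ρ`), `Φ((1−ρ)·d) = (−ρ²)^kΦ(d)` (`(1−ρ)·d = (2d₁ − d₂, d₁ + d₂)`;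
`χ(1−ρ) = (1−ρ)⁴ ≡ −ρ² (mod 5)`). The `24` nonzero classes are `(−1)^s ρ^j (1−ρ)^a ↔ N^s U^j e_a` (`s < 2`, `j < 3`, `a < 4`; `e = (0,1), (4,1), (2,0),
(4,2)`; `univ_eq_insert_image`, `orbit_injective`, checked by `decide`), on which `Φ = ρ^{jk}(−ρ²)^{ak}` (`phi_neg_iterate`, `phi_rho_iterate`, `phi_base`) and
`π = ρ^{2j}π_{e_a}` (`pi_neg_iterate`, `pi_rho_iterate`; `π_{−d} = π_d`, `π_{ρ·d} = ρ²π_d`, p644272). Hence (`resolventSum_rho_eq_six_mul`) for `3 ∣ k + 2n`: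
`Σ_d Φ(d)π_dⁿ = Σ_{s,j,a} (ρ^{k+2n})^j (−ρ²)^{ak} π_{e_a}ⁿ = 2·3·Σ_a (−ρ²)^{ak}π_{e_a}ⁿ`. [cite: Serre1979, Ch. IV §2 Prop. 7]
[cite: IrelandRosen1982, Ch. 9 §3]
-/

noncomputable section

open scoped Classical
open Complex PeriodPair
open Literature.NumberTheory.EllipticCurves

namespace Summit.BirchSwinnertonDyer.BirchSwinnertonDyer.Theorems.BiquadraticEisensteinDescentManinDatumSupercuspidalCMInertResolventOrbitSumJZero

open Summit.BirchSwinnertonDyer.BirchSwinnertonDyer.Theorems.BiquadraticEisensteinDescentManinDatumSupercuspidalCMInertResolventBoundReductionJZero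
  (inv_normalizedX_divPointRho_rhoMul rho_pow_eq_one_iff)
open Summit.BirchSwinnertonDyer.BirchSwinnertonDyer.Theorems.BiquadraticEisensteinDescentManinDatumSupercuspidalCMInertResolventLabelsJZero
  (inv_normalizedX_divPointRho_neg)

/-! ## §1 The weight and the labels along the orbit -/

/-- `Φ` is constant under iterated negation. [folklore] -/
theorem phi_neg_iterate (Φ : ZMod 5 × ZMod 5 → ℂ) (hΦneg : ∀ d, Φ (-d) = Φ d) (s : ℕ) (d : ZMod 5 × ZMod 5) :
    Φ ((fun d : ZMod 5 × ZMod 5 ↦ -d)^[s] d) = Φ d := by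
  induction s generalizing d with
  | zero => rfl
  | succ s ih => rw [Function.iterate_succ', Function.comp_apply, hΦneg, ih]

/-- `Φ(ρ^j·d) = ρ^{jk}Φ(d)`. [cite: IrelandRosen1982, Ch. 9 §3] -/
theorem phi_rho_iterate {k : ℕ} (Φ : ZMod 5 × ZMod 5 → ℂ)
    (hΦrho : ∀ d : ZMod 5 × ZMod 5, Φ (d.2 - d.1, -d.1) = (UpperHalfPlane.ρ : ℂ) ^ k * Φ d) (j : ℕ) (d : ZMod 5 × ZMod 5) :
    Φ ((fun d : ZMod 5 × ZMod 5 ↦ ((d.2 - d.1, -d.1) : ZMod 5 × ZMod 5))^[j] d) = (UpperHalfPlane.ρ : ℂ) ^ (j * k) * Φ d := by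
  induction j generalizing d with
  | zero => simp
  | succ j ih => rw [Function.iterate_succ', Function.comp_apply, hΦrho, ih, ← mul_assoc, ← pow_add, Nat.succ_mul]; ring_nf

/-- `π` is constant under iterated negation (`℘` even). [folklore] -/
theorem pi_neg_iterate (s : ℕ) (d : ZMod 5 × ZMod 5) (ϖ : ℂ) :
    (℘[ofUpperHalfPlane UpperHalfPlane.ρ] (((((fun d : ZMod 5 × ZMod 5 ↦ -d)^[s] d).1.val : ℂ) * UpperHalfPlane.ρ + (((fun d : ZMod 5 × ZMod 5 ↦ -d)^[s] d).2.val : ℂ)) / 5) / ϖ ^ 2)⁻¹ =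
      (℘[ofUpperHalfPlane UpperHalfPlane.ρ] ((((d).1.val : ℂ) * UpperHalfPlane.ρ + ((d).2.val : ℂ)) / 5) / ϖ ^ 2)⁻¹ := by
  induction s generalizing d with
  | zero => rfl
  | succ s ih => rw [Function.iterate_succ', Function.comp_apply, inv_normalizedX_divPointRho_neg, ih]

/-- `π(ρ^j·d) = ρ^{2j}π(d)` (`℘(ρz) = ρ℘(z)`). [cite: Cox2013, §10.C] -/
theorem pi_rho_iterate (j : ℕ) (d : ZMod 5 × ZMod 5) (ϖ : ℂ) :
    (℘[ofUpperHalfPlane UpperHalfPlane.ρ] (((((fun d : ZMod 5 × ZMod 5 ↦ ((d.2 - d.1, -d.1) : ZMod 5 × ZMod 5))^[j] d).1.val : ℂ) * UpperHalfPlane.ρ + (((fun d : ZMod 5 × ZMod 5 ↦ ((d.2 - d.1, -d.1) : ZMod 5 × ZMod 5))^[j] d).2.val : ℂ)) / 5) / ϖ ^ 2)⁻¹ =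
      (UpperHalfPlane.ρ : ℂ) ^ (2 * j) * (℘[ofUpperHalfPlane UpperHalfPlane.ρ] ((((d).1.val : ℂ) * UpperHalfPlane.ρ + ((d).2.val : ℂ)) / 5) / ϖ ^ 2)⁻¹ := by
  induction j generalizing d with
  | zero => simp
  | succ j ih =>
    rw [Function.iterate_succ', Function.comp_apply, inv_normalizedX_divPointRho_rhoMul, ih, ← mul_assoc, ← pow_add]
    ring_nf

/-- `Φ` on the four base points: `Φ(e_a) = (−ρ²)^{ak}` (`e_{a+1} = (1−ρ)·e_a`, `Φ(e₀) = 1`). [cite: IrelandRosen1982, Ch. 9 §3] -/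
theorem phi_base {k : ℕ} (Φ : ZMod 5 × ZMod 5 → ℂ) (hΦone : Φ (0, 1) = 1)
    (hΦgen : ∀ d : ZMod 5 × ZMod 5, Φ (2 * d.1 - d.2, d.1 + d.2) = (-(UpperHalfPlane.ρ : ℂ) ^ 2) ^ k * Φ d) :
    Φ (0, 1) = 1 ∧ Φ (4, 1) = (-(UpperHalfPlane.ρ : ℂ) ^ 2) ^ k ∧ Φ (2, 0) = ((-(UpperHalfPlane.ρ : ℂ) ^ 2) ^ k) ^ 2 ∧
      Φ (4, 2) = ((-(UpperHalfPlane.ρ : ℂ) ^ 2) ^ k) ^ 3 := by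
  have e1 : ((2 * (0 : ZMod 5) - 1, (0 : ZMod 5) + 1) : ZMod 5 × ZMod 5) = (4, 1) := by decide
  have e2 : ((2 * (4 : ZMod 5) - 1, (4 : ZMod 5) + 1) : ZMod 5 × ZMod 5) = (2, 0) := by decide
  have e3 : ((2 * (2 : ZMod 5) - 0, (2 : ZMod 5) + 0) : ZMod 5 × ZMod 5) = (4, 2) := by decide
  have h1 : Φ (4, 1) = (-(UpperHalfPlane.ρ : ℂ) ^ 2) ^ k := by
    have h := hΦgen (0, 1); rw [e1, hΦone, mul_one] at h; exact h
  have h2 : Φ (2, 0) = ((-(UpperHalfPlane.ρ : ℂ) ^ 2) ^ k) ^ 2 := by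
    have h := hΦgen (4, 1); rw [e2, h1] at h; rw [h]; ring
  have h3 : Φ (4, 2) = ((-(UpperHalfPlane.ρ : ℂ) ^ 2) ^ k) ^ 3 := by
    have h := hΦgen (2, 0); rw [e3, h2] at h; rw [h]; ring
  exact ⟨hΦone, h1, h2, h3⟩

/-! ## §2 The orbit cover of `(ℤ/5)² ∖ 0` -/

/-- The `24`-element parametrisation `(s, j, a) ↦ (−1)^s ρ^j · e_a` of the nonzero classes is injective. [folklore] -/
theorem orbit_injective : Function.Injective (fun x : Fin 2 × Fin 3 × Fin 4 ↦
    (fun d : ZMod 5 × ZMod 5 ↦ -d)^[x.1.val] ((fun d : ZMod 5 × ZMod 5 ↦ ((d.2 - d.1, -d.1) : ZMod 5 × ZMod 5))^[x.2.1.val]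
      (![((0 : ZMod 5), (1 : ZMod 5)), (4, 1), (2, 0), (4, 2)] x.2.2))) := by
  decide

/-- The nonzero classes of `(ℤ/5)²` are exactly the `24` orbit points, plus `0`. [folklore] -/
theorem univ_eq_insert_image : (Finset.univ : Finset (ZMod 5 × ZMod 5)) =
    insert 0 (Finset.univ.image (fun x : Fin 2 × Fin 3 × Fin 4 ↦
      (fun d : ZMod 5 × ZMod 5 ↦ -d)^[x.1.val] ((fun d : ZMod 5 × ZMod 5 ↦ ((d.2 - d.1, -d.1) : ZMod 5 × ZMod 5))^[x.2.1.val]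
        (![((0 : ZMod 5), (1 : ZMod 5)), (4, 1), (2, 0), (4, 2)] x.2.2)))) := by
  decide

/-- `0` is not an orbit point. [folklore] -/
theorem zero_notMem_image : (0 : ZMod 5 × ZMod 5) ∉ (Finset.univ.image (fun x : Fin 2 × Fin 3 × Fin 4 ↦
      (fun d : ZMod 5 × ZMod 5 ↦ -d)^[x.1.val] ((fun d : ZMod 5 × ZMod 5 ↦ ((d.2 - d.1, -d.1) : ZMod 5 × ZMod 5))^[x.2.1.val]
        (![((0 : ZMod 5), (1 : ZMod 5)), (4, 1), (2, 0), (4, 2)] x.2.2)))) := by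
  decide

/-! ## §3 The orbit form of the resolvents -/

/-- ★ **Orbit form of the resolvent sums.** For `Φ : (ℤ/5)² → ℂ` with `Φ 0 = 0`, `Φ(0,1) = 1`, `Φ(−d) = Φ d`, `Φ(ρ·d) = ρ^kΦ(d)`,
`Φ((1−ρ)·d) = (−ρ²)^kΦ(d)`, and `n` with `3 ∣ k + 2n`:
`Σ_d Φ(d)·π_dⁿ = 6·(π_{(0,1)}ⁿ + (−ρ²)^k π_{(4,1)}ⁿ + ((−ρ²)^k)² π_{(2,0)}ⁿ + ((−ρ²)^k)³ π_{(4,2)}ⁿ)` (`π_d = (X(t_d))⁻¹`, any `ϖ`).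
[cite: Serre1979, Ch. IV §2 Prop. 7] [cite: IrelandRosen1982, Ch. 9 §3] -/
theorem resolventSum_rho_eq_six_mul {k : ℕ} (Φ : ZMod 5 × ZMod 5 → ℂ) (hΦ0 : Φ 0 = 0) (hΦone : Φ (0, 1) = 1)
    (hΦneg : ∀ d, Φ (-d) = Φ d)
    (hΦrho : ∀ d : ZMod 5 × ZMod 5, Φ (d.2 - d.1, -d.1) = (UpperHalfPlane.ρ : ℂ) ^ k * Φ d)
    (hΦgen : ∀ d : ZMod 5 × ZMod 5, Φ (2 * d.1 - d.2, d.1 + d.2) = (-(UpperHalfPlane.ρ : ℂ) ^ 2) ^ k * Φ d)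
    {n : ℕ} (hn : 3 ∣ k + 2 * n) (ϖ : ℂ) :
    ∑ d : ZMod 5 × ZMod 5, Φ d *
      (℘[ofUpperHalfPlane UpperHalfPlane.ρ] (((d.1.val : ℂ) * UpperHalfPlane.ρ + (d.2.val : ℂ)) / 5) / ϖ ^ 2)⁻¹ ^ n =
      6 * ((℘[ofUpperHalfPlane UpperHalfPlane.ρ] ((((((0, 1) : ZMod 5 × ZMod 5)).1.val : ℂ) * UpperHalfPlane.ρ +
            ((((0, 1) : ZMod 5 × ZMod 5)).2.val : ℂ)) / 5) / ϖ ^ 2)⁻¹ ^ n +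
        (-(UpperHalfPlane.ρ : ℂ) ^ 2) ^ k * (℘[ofUpperHalfPlane UpperHalfPlane.ρ] ((((((4, 1) : ZMod 5 × ZMod 5)).1.val : ℂ) * UpperHalfPlane.ρ +
            ((((4, 1) : ZMod 5 × ZMod 5)).2.val : ℂ)) / 5) / ϖ ^ 2)⁻¹ ^ n +
        ((-(UpperHalfPlane.ρ : ℂ) ^ 2) ^ k) ^ 2 * (℘[ofUpperHalfPlane UpperHalfPlane.ρ] ((((((2, 0) : ZMod 5 × ZMod 5)).1.val : ℂ) * UpperHalfPlane.ρ +
            ((((2, 0) : ZMod 5 × ZMod 5)).2.val : ℂ)) / 5) / ϖ ^ 2)⁻¹ ^ n +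
        ((-(UpperHalfPlane.ρ : ℂ) ^ 2) ^ k) ^ 3 * (℘[ofUpperHalfPlane UpperHalfPlane.ρ] ((((((4, 2) : ZMod 5 × ZMod 5)).1.val : ℂ) * UpperHalfPlane.ρ +
            ((((4, 2) : ZMod 5 × ZMod 5)).2.val : ℂ)) / 5) / ϖ ^ 2)⁻¹ ^ n) := by
  -- abbreviations
  set N : ZMod 5 × ZMod 5 → ZMod 5 × ZMod 5 := fun d ↦ -d with hN
  set U : ZMod 5 × ZMod 5 → ZMod 5 × ZMod 5 := fun d ↦ ((d.2 - d.1, -d.1) : ZMod 5 × ZMod 5) with hU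
  set e : Fin 4 → ZMod 5 × ZMod 5 := ![((0 : ZMod 5), (1 : ZMod 5)), (4, 1), (2, 0), (4, 2)] with he
  set φ : Fin 2 × Fin 3 × Fin 4 → ZMod 5 × ZMod 5 := fun x ↦ N^[x.1.val] (U^[x.2.1.val] (e x.2.2)) with hφ
  set f : ZMod 5 × ZMod 5 → ℂ := fun d ↦ Φ d *
      (℘[ofUpperHalfPlane UpperHalfPlane.ρ] (((d.1.val : ℂ) * UpperHalfPlane.ρ + (d.2.val : ℂ)) / 5) / ϖ ^ 2)⁻¹ ^ n with hf
  set π : ZMod 5 × ZMod 5 → ℂ := fun d ↦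
      (℘[ofUpperHalfPlane UpperHalfPlane.ρ] (((d.1.val : ℂ) * UpperHalfPlane.ρ + (d.2.val : ℂ)) / 5) / ϖ ^ 2)⁻¹ with hπ
  have hinj : Function.Injective φ := orbit_injective
  have huniv : (Finset.univ : Finset (ZMod 5 × ZMod 5)) = insert 0 (Finset.univ.image φ) := univ_eq_insert_image
  have h0 : (0 : ZMod 5 × ZMod 5) ∉ Finset.univ.image φ := zero_notMem_image
  -- the value of the summand on the orbit
  have hval : ∀ x : Fin 2 × Fin 3 × Fin 4, f (φ x) =
      ((UpperHalfPlane.ρ : ℂ) ^ (k + 2 * n)) ^ x.2.1.val * (((-(UpperHalfPlane.ρ : ℂ) ^ 2) ^ k) ^ x.2.2.val * π (e x.2.2) ^ n) := by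
    rintro ⟨s, j, a⟩
    have hΦ : Φ (φ (s, j, a)) = (UpperHalfPlane.ρ : ℂ) ^ (j.val * k) * ((-(UpperHalfPlane.ρ : ℂ) ^ 2) ^ k) ^ a.val := by
      simp only [hφ, hN, hU]
      rw [phi_neg_iterate Φ hΦneg, phi_rho_iterate Φ hΦrho]
      obtain ⟨b0, b1, b2, b3⟩ := phi_base Φ hΦone hΦgen
      fin_cases a <;> simp [he, b0, b1, b2, b3]
    have hP : π (φ (s, j, a)) = (UpperHalfPlane.ρ : ℂ) ^ (2 * j.val) * π (e a) := by
      simp only [hφ, hπ, hN, hU]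
      rw [pi_neg_iterate, pi_rho_iterate]
    show Φ (φ (s, j, a)) * π (φ (s, j, a)) ^ n = _
    rw [hΦ, hP]
    ring
  -- the geometric factor in `j`
  have hρ1 : (UpperHalfPlane.ρ : ℂ) ^ (k + 2 * n) = 1 := (rho_pow_eq_one_iff _).mpr hn
  -- rewrite the sum over the orbit
  have hsum : ∑ d : ZMod 5 × ZMod 5, f d = f 0 + ∑ x : Fin 2 × Fin 3 × Fin 4, f (φ x) := by
    rw [show (∑ d : ZMod 5 × ZMod 5, f d) = ∑ d ∈ (Finset.univ : Finset (ZMod 5 × ZMod 5)), f d from rfl, huniv,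
      Finset.sum_insert h0, Finset.sum_image (fun x _ y _ h ↦ hinj h)]
  have hf0 : f 0 = 0 := by simp only [hf]; rw [hΦ0, zero_mul]
  rw [show (∑ d : ZMod 5 × ZMod 5, Φ d *
      (℘[ofUpperHalfPlane UpperHalfPlane.ρ] (((d.1.val : ℂ) * UpperHalfPlane.ρ + (d.2.val : ℂ)) / 5) / ϖ ^ 2)⁻¹ ^ n) =
      ∑ d : ZMod 5 × ZMod 5, f d from rfl, hsum, hf0, zero_add]
  simp_rw [hval, hρ1, one_pow, one_mul]
  simp_rw [Fintype.sum_prod_type]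
  simp only [Finset.sum_const, Finset.card_univ, Fintype.card_fin, nsmul_eq_mul, Fin.sum_univ_four]
  have h3v : ((3 : Fin 4) : ℕ) = 3 := rfl
  simp only [he, hπ, Matrix.cons_val_zero, Matrix.cons_val_one, Matrix.head_cons, Matrix.cons_val_two, Matrix.tail_cons,
    Matrix.cons_val_three, Fin.val_zero, Fin.val_one, Fin.val_two, h3v, pow_zero, pow_one, one_mul]
  push_cast
  ring

end Summit.BirchSwinnertonDyer.BirchSwinnertonDyer.Theorems.BiquadraticEisensteinDescentManinDatumSupercuspidalCMInertResolventOrbitSumJZero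

end
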